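import Summits.RiemannHypothesis.RiemannHypothesis.Theorems.SoninFrameCriterion
import Summits.RiemannHypothesis.RiemannHypothesis.Theorems.SemilocalSoninPolyWeilSide
import HarnessLib

/-!
# The frame criterion for bounded (non-smooth) witnesses and polynomial windows — multi-vector certificate bridge

Cell `rh-explicit`, seat cc-s2-1 (HOME `run/shared/lean/pub/rh-explicit/`; lead R7-23).  `SoninFrameCriterion` refutes
the obligation `SemilocalSoninIneqOn p a` from a multi-vector near-Sonin section for a SMOOTH test function.  The
cell's certificates use a bounded polynomial window `G = g·1_{[−b,b]}` instead (all Weil-side quantities rational);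
this file passes to the limit along the mollifications `g_k = G ⋆ φ_k` exactly as the one-vector chain
(`SemilocalSoninLimitBridge`, `SemilocalSoninMollifyWeil`, `SemilocalSoninBridgeOne`, `SemilocalSoninPolyWeilSide`) does:

* `not_semilocalSoninIneqOn_of_bdd_witness_frame` : bounded measurable a.e.-continuous `G` off `[−b, b]` with CC's two
  moments; Sonin vectors `ζ_i` within `d_i` of explicit `η_i`; per-vector data `B_i ≤ Re⟨η_i|ϑ(T_p(G⋆G̃))η_i⟩`,
  `‖η_i‖ ≤ N_i`, Gram bounds `|⟪θη_i, θη_j⟫| ≤ g_ij`, `‖T_p(G⋆G̃)‖₁ < K`, the Weil side eventually `≤ C` along `g_k`;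
  Gershgorin rows with slack `≤ 1` and `C < Σ_i (B_i − K(2N_i + d_i)d_i)` ⇒ `¬ SemilocalSoninIneqOn p a` (`a > b`);
* `not_semilocalSoninIneqOn_two_of_bdd_witness_frame_one` : `p = 2`, the Weil side from the closed-form jump data
  `(log 2/√2)D_{log 2}(G) + ∫₀^∞ wD(G) − C₂‖G‖₂² < C`, the `ζ_i` from band energies by `SoninDistanceOne`;
* `not_semilocalSoninIneqOn_two_of_polyWitness_frame` : `G = polyWitness c.p c.b` with every `G`-hypothesis from
  rational checks (`SemilocalSoninPolyWindow/PolyWeilSide`) and all Sonin-side budgets rational — the multi-vector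
  analogue of `not_semilocalSoninIneqOn_two_of_polyWitness`.

Proof-only file (no definitions, no named facts); nothing here asserts that such data exist. [folklore]
-/

set_option linter.dupNamespace false  -- the mandated namespace repeats `RiemannHypothesis`

noncomputable section

open MeasureTheory Complex Set Filter Topology Finset FourierTransform
open scoped Real ComplexConjugate InnerProductSpace ENNReal

namespace Summit.RiemannHypothesis.RiemannHypothesis

open Literature.NumberTheory.LFunctions Literature.NumberTheory.LFunctions.WeilContinuous
  Literature.NumberTheory.ConnesConsani2021
  Summit.RiemannHypothesis.RiemannHypothesis.Theorems.MotivicDoor.SemilocalMarkov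

section Limit

variable (p : ℕ) [hp : Fact p.Prime] {G : ℝ → ℂ} {b M : ℝ}

/-- **Multi-vector refutation from a bounded (non-smooth) witness** — limit form of
`not_semilocalSoninIneqOn_of_near_frame` along the mollifications `g_k = G ⋆ φ_k`. [folklore] -/
theorem not_semilocalSoninIneqOn_of_bdd_witness_frame {a : ℝ} (hGm : Measurable G) (hM : ∀ x, ‖G x‖ ≤ M)
    (hGb : ∀ x, b < |x| → G x = 0) (hb : 0 ≤ b) (hab : b < a) (hGc : ∀ᵐ x : ℝ, ContinuousAt G x)
    (h1 : mulFourier G (I / 2) = 0) (h0 : mulFourier G 0 = 0)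
    {m : ℕ} {η ζ : Fin m → Lp ℂ 2 (volume : Measure ℝ)} (hζ : ∀ i, ζ i ∈ soninSpace 1 1)
    {d N B : Fin m → ℝ} {Gb : Fin m → Fin m → ℝ} {C K : ℝ}
    (hd : ∀ i, ‖η i - ζ i‖ ≤ d i) (hN : ∀ i, ‖η i‖ ≤ N i)
    (hB : ∀ i, B i ≤ (soninTraceForm (twistKernel p (weilConv G (weilReflect G))) (η i : ℝ → ℂ)).re)
    (hGram : ∀ i j, ‖⟪primeTwist p (η i), primeTwist p (η j)⟫_ℂ‖ ≤ Gb i j)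
    (hC : ∀ᶠ k : ℕ in atTop, (archW (weilConv (weilConv G (moll k)) (weilReflect (weilConv G (moll k))))
      - weilSemilocalPrimeTerm {p} (weilConv (weilConv G (moll k)) (weilReflect (weilConv G (moll k))))).re ≤ C)
    (hK : ∫ τ, ‖twistKernel p (weilConv G (weilReflect G)) τ‖ < K)
    (hrow : ∀ i, ∑ j, (Gb i j + 4 * (d i * (N j + d j) + N i * d j)) ≤ 1)
    (hineq : C < ∑ i, (B i - K * ((2 * N i + d i) * d i))) :
    ¬ SemilocalSoninIneqOn p a := by
  -- the slack, split evenly over the `m` vectors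
  set s : ℝ := (∑ i, (B i - K * ((2 * N i + d i) * d i))) - C with hs
  have hs0 : 0 < s := by rw [hs]; linarith
  set δ : ℝ := s / (2 * ((m : ℝ) + 1)) with hδ
  have hm0 : (0 : ℝ) < (m : ℝ) + 1 := by positivity
  have hδ0 : 0 < δ := by positivity
  have hmδ : (m : ℝ) * δ < s := by
    have e : (m : ℝ) * δ = s * ((m : ℝ) / (2 * ((m : ℝ) + 1))) := by rw [hδ]; ring
    have hfrac : (m : ℝ) / (2 * ((m : ℝ) + 1)) < 1 := by
      rw [div_lt_one (by positivity)]; linarith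
    rw [e]
    calc s * ((m : ℝ) / (2 * ((m : ℝ) + 1))) < s * 1 := mul_lt_mul_of_pos_left hfrac hs0
      _ = s := mul_one s
  -- (i) every Sonin term along `g_k` is eventually within `δ` of its limit
  have e1 : ∀ᶠ k : ℕ in atTop, ∀ i, ‖soninTraceForm (twistKernel p
      (weilConv (weilConv G (moll k)) (weilReflect (weilConv G (moll k))))) (η i : ℝ → ℂ)
      - soninTraceForm (twistKernel p (weilConv G (weilReflect G))) (η i : ℝ → ℂ)‖ < δ := by
    refine eventually_all.2 fun i ↦ ?_
    have hT := tendsto_soninTraceForm_twistKernel_moll p hGm hM hGb hb hGc (η i)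
    exact (tendsto_iff_norm_sub_tendsto_zero.mp hT).eventually (gt_mem_nhds hδ0)
  -- (ii) the twisted kernels' `L¹` norms are eventually `≤ K`
  have e2 : ∀ᶠ k : ℕ in atTop,
      ∫ τ, ‖twistKernel p (weilConv (weilConv G (moll k)) (weilReflect (weilConv G (moll k)))) τ‖ ≤ K := by
    have hgap : 0 < K - ∫ τ, ‖twistKernel p (weilConv G (weilReflect G)) τ‖ := by linarith
    have h := (tendsto_integral_norm_twistKernel_moll_sub p hGm hM hGb hb hGc).eventually (gt_mem_nhds hgap)
    filter_upwards [h] with k hk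
    have hGi : Integrable G := integrable_of_bdd hGm hM hGb
    have hkG : Integrable (twistKernel p (weilConv G (weilReflect G))) := by
      refine integrable_twistKernel p ?_
      unfold weilConv
      exact hGi.integrable_convolution (ContinuousLinearMap.mul ℂ ℂ) (Theorems.PfPersistence.integrable_weilReflect hGi)
    have hkk : Integrable (twistKernel p (weilConv (weilConv G (moll k)) (weilReflect (weilConv G (moll k))))) :=
      integrable_twistKernel p (integrable_weilConv_weilReflect (isWeilTest_weilConv_moll_of_bdd hGm hM hGb k))
    have htri : ∫ τ, ‖twistKernel p (weilConv (weilConv G (moll k)) (weilReflect (weilConv G (moll k)))) τ‖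
        ≤ (∫ τ, ‖twistKernel p (weilConv G (weilReflect G)) τ‖)
          + ∫ τ, ‖twistKernel p (weilConv (weilConv G (moll k)) (weilReflect (weilConv G (moll k)))) τ
            - twistKernel p (weilConv G (weilReflect G)) τ‖ := by
      have n1 : Integrable (fun τ : ℝ ↦ ‖twistKernel p (weilConv G (weilReflect G)) τ‖) := hkG.norm
      have n2 : Integrable (fun τ : ℝ ↦
          ‖twistKernel p (weilConv (weilConv G (moll k)) (weilReflect (weilConv G (moll k)))) τ
            - twistKernel p (weilConv G (weilReflect G)) τ‖) := (hkk.sub hkG).norm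
      rw [← integral_add n1 n2]
      refine integral_mono_of_nonneg (Eventually.of_forall fun _ ↦ norm_nonneg _)
        (n1.add n2) (Eventually.of_forall fun τ ↦ ?_)
      exact norm_le_norm_add_norm_sub' _ _
    linarith
  -- (iii) the Weil side is eventually `≤ C` (`hC`); (iv) the support is eventually inside `[−a, a]`
  have e4 : ∀ᶠ k : ℕ in atTop, b + (bump k).rOut ≤ a := by
    have h : Tendsto (fun k : ℕ ↦ b + (bump k).rOut) atTop (𝓝 (b + 0)) := tendsto_bump_rOut.const_add b
    rw [add_zero] at h
    exact h.eventually (Iic_mem_nhds hab)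
  obtain ⟨k, ⟨hk1, hk2⟩, hk3, hk4⟩ := ((e1.and e2).and (hC.and e4)).exists
  -- the smooth test function `g_k`
  set g : ℝ → ℂ := weilConv G (moll k) with hg
  have hgt : IsWeilTest g := isWeilTest_weilConv_moll_of_bdd hGm hM hGb k
  have hsupp : tsupport g ⊆ Icc (-a) a :=
    (tsupport_weilConv_moll_subset_of_bdd hGb k).trans (Icc_subset_Icc (by linarith) hk4)
  have hg1 : mulFourier g (I / 2) = 0 := mulFourier_weilConv_moll_eq_zero hGm hM hGb h1 k
  have hg0 : mulFourier g 0 = 0 := mulFourier_weilConv_moll_eq_zero hGm hM hGb h0 k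
  -- the Sonin data at `g_k`, each lowered by `δ`
  have hB' : ∀ i, B i - δ ≤ (soninTraceForm (twistKernel p (weilConv g (weilReflect g))) (η i : ℝ → ℂ)).re :=
    fun i ↦ by
    have h := (Complex.abs_re_le_norm _).trans (hk1 i).le
    rw [Complex.sub_re] at h
    have h' := (abs_le.mp h).1
    linarith [hB i]
  refine not_semilocalSoninIneqOn_of_near_frame p hgt hsupp hg1 hg0 hζ hd hN hB' hGram hk2 hrow ?_
  refine hk3.trans_lt ?_
  have hsum : ∑ i, (B i - δ - K * ((2 * N i + d i) * d i))
      = (∑ i, (B i - K * ((2 * N i + d i) * d i))) - (m : ℝ) * δ := by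
    rw [Finset.sum_sub_distrib, Finset.sum_sub_distrib, Finset.sum_sub_distrib, Finset.sum_const, Finset.card_fin,
      nsmul_eq_mul]
    ring
  rw [hsum]
  rw [hs] at hmδ
  linarith

end Limit

section Two

variable {G : ℝ → ℂ} {b M : ℝ}

/-- **Multi-vector refutation of `SemilocalSoninIneqOn 2 a` from closed-form data.**  As
`not_semilocalSoninIneqOn_two_of_bdd_witness_one`, with the single near-Sonin vector replaced by a near-Sonin SECTION
`η_1, …, η_m` (a.e. even, a.e. zero on `[−1,1]`, band energies `ε_i`, `ε_i/(1 − 9999428/10⁷) ≤ d_i²`, `0 ≤ d_i`),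
per-vector data `B_i ≤ Re⟨η_i|ϑ(T_2(G⋆G̃))η_i⟩`, `‖η_i‖ ≤ N_i`, Gram bounds `|⟪θ_2η_i, θ_2η_j⟫| ≤ g_ij`, the
Gershgorin rows `Σ_j (g_ij + 4(d_i(N_j + d_j) + N_i d_j)) ≤ 1` and `C < Σ_i (B_i − K(2N_i + d_i)d_i)`. [folklore] -/
theorem not_semilocalSoninIneqOn_two_of_bdd_witness_frame_one {a : ℝ} (hGm : Measurable G) (hM : ∀ x, ‖G x‖ ≤ M)
    (hGb : ∀ x, b < |x| → G x = 0) (hb : 0 ≤ b) (hab : b < a) (hb2 : b < Real.log 2)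
    (hGc : ∀ᵐ x : ℝ, ContinuousAt G x)
    (hfin : IntegrableOn (fun t ↦ weilArchDensity t * weilIncrement G t) (Ioi 0))
    (h1 : mulFourier G (I / 2) = 0) (h0 : mulFourier G 0 = 0)
    {m : ℕ} {η : Fin m → Lp ℂ 2 (volume : Measure ℝ)} (hev : ∀ i, η i ∈ evenPart) (hvan : ∀ i, η i ∈ vanishOn 1)
    {ε d N B : Fin m → ℝ} {Gb : Fin m → Fin m → ℝ} {C K : ℝ}
    (hε : ∀ i, ∫ x in Icc (-1 : ℝ) 1, ‖((𝓕 (η i) : Lp ℂ 2 (volume : Measure ℝ)) : ℝ → ℂ) x‖ ^ 2 ≤ ε i)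
    (hdε : ∀ i, ε i / (1 - 9999428 / 10000000) ≤ d i ^ 2) (hd0 : ∀ i, 0 ≤ d i) (hN : ∀ i, ‖η i‖ ≤ N i)
    (hB : ∀ i, B i ≤ (soninTraceForm (twistKernel 2 (weilConv G (weilReflect G))) (η i : ℝ → ℂ)).re)
    (hGram : ∀ i j, ‖⟪primeTwist 2 (η i), primeTwist 2 (η j)⟫_ℂ‖ ≤ Gb i j)
    (hC : Real.log 2 / Real.sqrt 2 * weilIncrement G (Real.log 2) +
        (∫ t in Ioi (0 : ℝ), weilArchDensity t * weilIncrement G t) -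
        semilocalTwoConstant * ∫ x : ℝ, ‖G x‖ ^ 2 < C)
    (hK : ∫ τ, ‖twistKernel 2 (weilConv G (weilReflect G)) τ‖ < K)
    (hrow : ∀ i, ∑ j, (Gb i j + 4 * (d i * (N j + d j) + N i * d j)) ≤ 1)
    (hineq : C < ∑ i, (B i - K * ((2 * N i + d i) * d i))) :
    ¬ SemilocalSoninIneqOn 2 a := by
  haveI : Fact (Nat.Prime 2) := ⟨Nat.prime_two⟩
  choose ζ hζ hest using fun i ↦ SoninDistance.exists_mem_soninSpace_one_one_norm_sub_sq_le (η i) (hev i) (hvan i)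
  have hd : ∀ i, ‖η i - ζ i‖ ≤ d i := fun i ↦ by
    have hsq : ‖η i - ζ i‖ ^ 2 ≤ d i ^ 2 :=
      (hest i).trans ((div_le_div_of_nonneg_right (hε i) (by norm_num)).trans (hdε i))
    exact (pow_le_pow_iff_left₀ (norm_nonneg _) (hd0 i) two_ne_zero).mp hsq
  exact not_semilocalSoninIneqOn_of_bdd_witness_frame 2 hGm hM hGb hb hab hGc h1 h0 hζ hd hN hB hGram
    (eventually_re_semilocalSide_two_moll_le hGm hM hGb hb2 hGc hfin hC) hK hrow hineq

end Two

end Summit.RiemannHypothesis.RiemannHypothesis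

/-! ## Polynomial windows: every `G`-hypothesis from rationals -/

namespace Summit.RiemannHypothesis.RiemannHypothesis.Theorems.SemilocalPolyWitness

open Literature.NumberTheory.LFunctions Literature.NumberTheory.ConnesConsani2021
  Summit.RiemannHypothesis.RiemannHypothesis.Theorems.MotivicDoor
  Summit.RiemannHypothesis.RiemannHypothesis.Theorems.MotivicDoor.SemilocalMarkov LQ
  Summit.RiemannHypothesis.RiemannHypothesis.SoninCert

/-- **Multi-vector certificate against `SemilocalSoninIneqOn 2 a` (`a > b`) with a polynomial window.**  Test-function
side as in `not_semilocalSoninIneqOn_two_of_polyWitness` (`c : WeilNegCert2` read without oddness, `g = F″ + F′/2`,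
`F(±b) = F′(±b) = 0`, enclosure side conditions, budgets `c.lhsQ − c2SharpQ·normSq < C` and
`(3/2 + 1.41422)·2b·normSq < K`); Sonin side a section `η_1, …, η_m` with RATIONAL budgets `ε_i, d_i, N_i, B_i, g_ij`;
the two final checks `Σ_j (g_ij + 4(d_i(N_j + d_j) + N_i d_j)) ≤ 1` (each `i`) and `C < Σ_i (B_i − K(2N_i + d_i)d_i)` in
`ℚ`. [folklore] -/
theorem not_semilocalSoninIneqOn_two_of_polyWitness_frame (c : WeilNegCert2) {F : List ℚ}
    (hb0 : 0 < c.b) (hb1 : c.b ≤ 1) (hblog : c.b < logTwoLo20) (h2b : logTwoHi20 ≤ 2 * c.b)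
    (hnA : 0 < c.nA) (hnt : 0 < c.nt) (hhead : (incrementL c.p c.b).headD 0 = 0)
    (htail1 : invPartialExpQ c.nt (2 * (2 * c.b)) < 1)
    (hg : c.p = add (derivL (derivL F)) (smul (1 / 2) (derivL F)))
    (hF1 : evQ (derivL F) c.b = 0) (hF2 : evQ (derivL F) (-c.b) = 0)
    (hF3 : evQ F c.b = 0) (hF4 : evQ F (-c.b) = 0)
    {C K : ℚ} (hC : c.lhsQ - c2SharpQ * LQ.normSq c.p c.b < C)
    (hK : (3 / 2 + 141422 / 100000) * (2 * c.b) * LQ.normSq c.p c.b < K)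
    {m : ℕ} {η : Fin m → Lp ℂ 2 (volume : Measure ℝ)} (hev : ∀ i, η i ∈ evenPart) (hvan : ∀ i, η i ∈ vanishOn 1)
    {ε d N B : Fin m → ℚ} {Gb : Fin m → Fin m → ℚ}
    (hε : ∀ i, ∫ x in Set.Icc (-1 : ℝ) 1, ‖((𝓕 (η i) : Lp ℂ 2 (volume : Measure ℝ)) : ℝ → ℂ) x‖ ^ 2 ≤ ε i)
    (hdε : ∀ i, ε i * 10000000 / 572 ≤ d i ^ 2) (hd0 : ∀ i, 0 ≤ d i) (hN : ∀ i, ‖η i‖ ≤ N i)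
    (hB : ∀ i, (B i : ℝ) ≤ (soninTraceForm (twistKernel 2
      (weilConv (polyWitness c.p c.b) (weilReflect (polyWitness c.p c.b)))) (η i : ℝ → ℂ)).re)
    (hGram : ∀ i j, ‖⟪primeTwist 2 (η i), primeTwist 2 (η j)⟫_ℂ‖ ≤ Gb i j)
    (hrow : ∀ i, ∑ j, (Gb i j + 4 * (d i * (N j + d j) + N i * d j)) ≤ 1)
    (hineq : C < ∑ i, (B i - K * ((2 * N i + d i) * d i)))
    {a : ℝ} (ha : (c.b : ℝ) < a) : ¬ SemilocalSoninIneqOn 2 a := by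
  have hblt : (c.b : ℝ) < Real.log 2 := lt_of_lt_of_le (by exact_mod_cast hblog) logTwoLo20_le
  obtain ⟨hfin, _⟩ := weilSide_polyWitness_le_lhsQ c hb0 hb1 h2b hnA hnt hhead htail1
  have hCw := weilSide_polyWitness_lt c hb0 hb1 h2b hnA hnt hhead htail1 hC
  have h1 : mulFourier (polyWitness c.p c.b) (I / 2) = 0 :=
    mulFourier_polyWitness_I_half_eq_zero hb0 hg hF1 hF2
  have h0 : mulFourier (polyWitness c.p c.b) 0 = 0 :=
    mulFourier_polyWitness_zero_eq_zero hb0 hg hF1 hF2 hF3 hF4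
  have hKr := integral_norm_twistKernel_polyWitness_lt (p := c.p) hb0 hK
  have hdε' : ∀ i, ((ε i : ℚ) : ℝ) / (1 - 9999428 / 10000000) ≤ ((d i : ℚ) : ℝ) ^ 2 := fun i ↦ by
    have h : ((ε i * 10000000 / 572 : ℚ) : ℝ) ≤ ((d i ^ 2 : ℚ) : ℝ) := Rat.cast_le.2 (hdε i)
    push_cast at h
    have e : ((ε i : ℚ) : ℝ) / (1 - 9999428 / 10000000) = (ε i : ℝ) * 10000000 / 572 := by norm_num; ring
    rw [e]; exact h
  have hrow' : ∀ i, ∑ j, (((Gb i j : ℚ) : ℝ) + 4 * ((d i : ℝ) * ((N j : ℝ) + d j) + (N i : ℝ) * d j)) ≤ 1 :=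
    fun i ↦ by
    have h := (Rat.cast_le (K := ℝ)).2 (hrow i)
    push_cast at h
    exact h
  have hineq' : ((C : ℚ) : ℝ) < ∑ i, (((B i : ℚ) : ℝ) - (K : ℝ) * ((2 * (N i : ℝ) + d i) * d i)) := by
    have h := (Rat.cast_lt (K := ℝ)).2 hineq
    push_cast at h
    exact h
  exact not_semilocalSoninIneqOn_two_of_bdd_witness_frame_one (G := polyWitness c.p c.b)
    (M := (absBound c.p c.b : ℝ)) measurable_polyWitness (norm_polyWitness_le hb0)
    (fun _ hx ↦ polyWitness_eq_zero_of_lt hx) (by exact_mod_cast hb0.le) ha hblt ae_continuousAt_polyWitness hfin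
    h1 h0 hev hvan hε hdε' (fun i ↦ by exact_mod_cast hd0 i) hN hB hGram hCw hKr hrow' hineq'

end Summit.RiemannHypothesis.RiemannHypothesis.Theorems.SemilocalPolyWitness

end
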